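import Mathlib
import Summits.Ventures.PercRepro2.TypedMaskStar

/-!
# The pieces of the degree-three star on an arbitrary base (blind cell PercRepro2, p2 g3,
2026-08-25) — mine-1 §23.1's identities over any base

The star sums at the eight mixed type vectors are the copy-symmetrised PIECES `pN`, `pE`, `pE2`,
`pM`, `pC`, `pB` of the masked counts of the base, with the same nonnegative integer coefficients
as on `K₅` (TypedStarPieces.lean): the objects over which the hyperstar Props quantify, on any base
— a hyperedge in one / two copies (`pE` / `pE2` of a clique), the mixed objects `pM` / `pC` / `pB`.
-/

namespace Summit.Ventures.PercRepro2

namespace CovForm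

namespace TypedRed

namespace Mask

open TwoTerm OneTyped

/-! ## The pieces on an arbitrary base (mine-1 §23.1) -/

section Pieces

open Classical

variable {V : Type*} [DecidableEq V] {E : Type*} [Fintype E] [DecidableEq E]
variable {R : Type*} [Field R]
variable (F : Finset E) (z : Config E) (τ : E → ℕ) (ends : E → Sym2 V) (o a₁ a₂ a₃ b : V)

/-- `N(B)`: no mask. -/
noncomputable def pN : R := maskCount F z τ ends o a₁ a₂ a₃ b ∅ ∅ ∅

/-- `N(B + S(1))`: the object `S` open in exactly one copy. -/
noncomputable def pE (S : Finset (V × V)) : R :=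
  maskCount F z τ ends o a₁ a₂ a₃ b S ∅ ∅ + maskCount F z τ ends o a₁ a₂ a₃ b ∅ S ∅ +
    maskCount F z τ ends o a₁ a₂ a₃ b ∅ ∅ S

/-- `N(B + S(2))`: the object `S` open in exactly two copies. -/
noncomputable def pE2 (S : Finset (V × V)) : R :=
  maskCount F z τ ends o a₁ a₂ a₃ b S S ∅ + maskCount F z τ ends o a₁ a₂ a₃ b S ∅ S +
    maskCount F z τ ends o a₁ a₂ a₃ b ∅ S S

/-- `M(B, T, S)`: `T` in one copy, `S` in another (six ordered placements). -/
noncomputable def pM (T S : Finset (V × V)) : R :=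
  maskCount F z τ ends o a₁ a₂ a₃ b T S ∅ + maskCount F z τ ends o a₁ a₂ a₃ b T ∅ S +
    maskCount F z τ ends o a₁ a₂ a₃ b S T ∅ + maskCount F z τ ends o a₁ a₂ a₃ b ∅ T S +
    maskCount F z τ ends o a₁ a₂ a₃ b S ∅ T + maskCount F z τ ends o a₁ a₂ a₃ b ∅ S T

/-- Two different objects in two different copies (six ordered placements). -/
noncomputable def pC (S S' : Finset (V × V)) : R :=
  maskCount F z τ ends o a₁ a₂ a₃ b S S' ∅ + maskCount F z τ ends o a₁ a₂ a₃ b S ∅ S' +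
    maskCount F z τ ends o a₁ a₂ a₃ b S' S ∅ + maskCount F z τ ends o a₁ a₂ a₃ b ∅ S S' +
    maskCount F z τ ends o a₁ a₂ a₃ b S' ∅ S + maskCount F z τ ends o a₁ a₂ a₃ b ∅ S' S

/-- Three objects in the three copies (six placements). -/
noncomputable def pB (S₁ S₂ S₃ : Finset (V × V)) : R :=
  maskCount F z τ ends o a₁ a₂ a₃ b S₁ S₂ S₃ + maskCount F z τ ends o a₁ a₂ a₃ b S₁ S₃ S₂ +
    maskCount F z τ ends o a₁ a₂ a₃ b S₂ S₁ S₃ + maskCount F z τ ends o a₁ a₂ a₃ b S₂ S₃ S₁ +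
    maskCount F z τ ends o a₁ a₂ a₃ b S₃ S₁ S₂ + maskCount F z τ ends o a₁ a₂ a₃ b S₃ S₂ S₁

omit [DecidableEq V] in
/-- `pC` is symmetric in its two objects. -/
lemma pC_comm (S S' : Finset (V × V)) :
    pC F z τ ends o a₁ a₂ a₃ b S S' = (pC F z τ ends o a₁ a₂ a₃ b S' S : R) := by
  unfold pC; ring

variable (v₁ v₂ v₃ : V)

/-- `(1,1,1) = 6 N(B) + 2 Σ_e N(B + e(1)) + N(B + T(1))`. -/
theorem starSumM_111_pieces :
    starSumM (R := R) F z τ ends o a₁ a₂ a₃ b v₁ v₂ v₃ 1 1 1 =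
      6 * pN F z τ ends o a₁ a₂ a₃ b +
        2 * (pE F z τ ends o a₁ a₂ a₃ b (cliq {v₁, v₂}) + pE F z τ ends o a₁ a₂ a₃ b (cliq {v₁, v₃}) +
          pE F z τ ends o a₁ a₂ a₃ b (cliq {v₂, v₃})) +
        pE F z τ ends o a₁ a₂ a₃ b (cliq {v₁, v₂, v₃}) := by
  unfold starSumM
  simp only [Fintype.sum_bool, Bool.toNat_true, Bool.toNat_false, Nat.reduceEqDiff, if_true,
    if_false, add_zero, zero_add, sMask_fff, sMask_tff, sMask_ftf, sMask_fft, sMask_ttf, sMask_tft,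
    sMask_ftt, sMask_ttt]
  unfold pN pE
  ring

/-- `(1,1,2) = N(B + e₁₂(1)) + 2 N(B + e₁₃(1)) + 2 N(B + e₂₃(1)) + N(B + T(1)) + [pC e₁₃ e₂₃ + N(B + T(1))]`. -/
theorem starSumM_112_pieces :
    starSumM (R := R) F z τ ends o a₁ a₂ a₃ b v₁ v₂ v₃ 1 1 2 =
      pE F z τ ends o a₁ a₂ a₃ b (cliq {v₁, v₂}) + 2 * pE F z τ ends o a₁ a₂ a₃ b (cliq {v₁, v₃}) +
        2 * pE F z τ ends o a₁ a₂ a₃ b (cliq {v₂, v₃}) + pE F z τ ends o a₁ a₂ a₃ b (cliq {v₁, v₂, v₃}) +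
        (pC F z τ ends o a₁ a₂ a₃ b (cliq {v₁, v₃}) (cliq {v₂, v₃}) +
          pE F z τ ends o a₁ a₂ a₃ b (cliq {v₁, v₂, v₃})) := by
  unfold starSumM
  simp only [Fintype.sum_bool, Bool.toNat_true, Bool.toNat_false, Nat.reduceEqDiff, if_true,
    if_false, add_zero, zero_add, sMask_fff, sMask_tff, sMask_ftf, sMask_fft, sMask_ttf, sMask_tft,
    sMask_ftt, sMask_ttt]
  unfold pE pC
  ring

/-- `(1,2,1)`. -/
theorem starSumM_121_pieces :
    starSumM (R := R) F z τ ends o a₁ a₂ a₃ b v₁ v₂ v₃ 1 2 1 =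
      2 * pE F z τ ends o a₁ a₂ a₃ b (cliq {v₁, v₂}) + pE F z τ ends o a₁ a₂ a₃ b (cliq {v₁, v₃}) +
        2 * pE F z τ ends o a₁ a₂ a₃ b (cliq {v₂, v₃}) + pE F z τ ends o a₁ a₂ a₃ b (cliq {v₁, v₂, v₃}) +
        (pC F z τ ends o a₁ a₂ a₃ b (cliq {v₁, v₂}) (cliq {v₂, v₃}) +
          pE F z τ ends o a₁ a₂ a₃ b (cliq {v₁, v₂, v₃})) := by
  unfold starSumM
  simp only [Fintype.sum_bool, Bool.toNat_true, Bool.toNat_false, Nat.reduceEqDiff, if_true,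
    if_false, add_zero, zero_add, sMask_fff, sMask_tff, sMask_ftf, sMask_fft, sMask_ttf, sMask_tft,
    sMask_ftt, sMask_ttt]
  unfold pE pC
  ring

/-- `(2,1,1)`. -/
theorem starSumM_211_pieces :
    starSumM (R := R) F z τ ends o a₁ a₂ a₃ b v₁ v₂ v₃ 2 1 1 =
      2 * pE F z τ ends o a₁ a₂ a₃ b (cliq {v₁, v₂}) + 2 * pE F z τ ends o a₁ a₂ a₃ b (cliq {v₁, v₃}) +
        pE F z τ ends o a₁ a₂ a₃ b (cliq {v₂, v₃}) + pE F z τ ends o a₁ a₂ a₃ b (cliq {v₁, v₂, v₃}) +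
        (pC F z τ ends o a₁ a₂ a₃ b (cliq {v₁, v₂}) (cliq {v₁, v₃}) +
          pE F z τ ends o a₁ a₂ a₃ b (cliq {v₁, v₂, v₃})) := by
  unfold starSumM
  simp only [Fintype.sum_bool, Bool.toNat_true, Bool.toNat_false, Nat.reduceEqDiff, if_true,
    if_false, add_zero, zero_add, sMask_fff, sMask_tff, sMask_ftf, sMask_fft, sMask_ttf, sMask_tft,
    sMask_ftt, sMask_ttt]
  unfold pE pC
  ring

/-- `(1,2,2) = N(B + e₂₃(2)) + M(B, T, e₂₃) + [pC e₁₂ e₂₃ + N(B + T(1))] + [pC e₁₃ e₂₃ + N(B + T(1))]`. -/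
theorem starSumM_122_pieces :
    starSumM (R := R) F z τ ends o a₁ a₂ a₃ b v₁ v₂ v₃ 1 2 2 =
      pE2 F z τ ends o a₁ a₂ a₃ b (cliq {v₂, v₃}) +
        pM F z τ ends o a₁ a₂ a₃ b (cliq {v₁, v₂, v₃}) (cliq {v₂, v₃}) +
        (pC F z τ ends o a₁ a₂ a₃ b (cliq {v₁, v₂}) (cliq {v₂, v₃}) +
          pE F z τ ends o a₁ a₂ a₃ b (cliq {v₁, v₂, v₃})) +
        (pC F z τ ends o a₁ a₂ a₃ b (cliq {v₁, v₃}) (cliq {v₂, v₃}) +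
          pE F z τ ends o a₁ a₂ a₃ b (cliq {v₁, v₂, v₃})) := by
  unfold starSumM
  simp only [Fintype.sum_bool, Bool.toNat_true, Bool.toNat_false, Nat.reduceEqDiff, if_true,
    if_false, add_zero, zero_add, sMask_fff, sMask_tff, sMask_ftf, sMask_fft, sMask_ttf, sMask_tft,
    sMask_ftt, sMask_ttt]
  unfold pE pE2 pM pC
  ring

/-- `(2,1,2)`. -/
theorem starSumM_212_pieces :
    starSumM (R := R) F z τ ends o a₁ a₂ a₃ b v₁ v₂ v₃ 2 1 2 =
      pE2 F z τ ends o a₁ a₂ a₃ b (cliq {v₁, v₃}) +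
        pM F z τ ends o a₁ a₂ a₃ b (cliq {v₁, v₂, v₃}) (cliq {v₁, v₃}) +
        (pC F z τ ends o a₁ a₂ a₃ b (cliq {v₁, v₂}) (cliq {v₁, v₃}) +
          pE F z τ ends o a₁ a₂ a₃ b (cliq {v₁, v₂, v₃})) +
        (pC F z τ ends o a₁ a₂ a₃ b (cliq {v₁, v₃}) (cliq {v₂, v₃}) +
          pE F z τ ends o a₁ a₂ a₃ b (cliq {v₁, v₂, v₃})) := by
  unfold starSumM
  simp only [Fintype.sum_bool, Bool.toNat_true, Bool.toNat_false, Nat.reduceEqDiff, if_true,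
    if_false, add_zero, zero_add, sMask_fff, sMask_tff, sMask_ftf, sMask_fft, sMask_ttf, sMask_tft,
    sMask_ftt, sMask_ttt]
  unfold pE pE2 pM pC
  ring

/-- `(2,2,1)`. -/
theorem starSumM_221_pieces :
    starSumM (R := R) F z τ ends o a₁ a₂ a₃ b v₁ v₂ v₃ 2 2 1 =
      pE2 F z τ ends o a₁ a₂ a₃ b (cliq {v₁, v₂}) +
        pM F z τ ends o a₁ a₂ a₃ b (cliq {v₁, v₂, v₃}) (cliq {v₁, v₂}) +
        (pC F z τ ends o a₁ a₂ a₃ b (cliq {v₁, v₂}) (cliq {v₁, v₃}) +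
          pE F z τ ends o a₁ a₂ a₃ b (cliq {v₁, v₂, v₃})) +
        (pC F z τ ends o a₁ a₂ a₃ b (cliq {v₁, v₂}) (cliq {v₂, v₃}) +
          pE F z τ ends o a₁ a₂ a₃ b (cliq {v₁, v₂, v₃})) := by
  unfold starSumM
  simp only [Fintype.sum_bool, Bool.toNat_true, Bool.toNat_false, Nat.reduceEqDiff, if_true,
    if_false, add_zero, zero_add, sMask_fff, sMask_tff, sMask_ftf, sMask_fft, sMask_ttf, sMask_tft,
    sMask_ftt, sMask_ttt]
  unfold pE pE2 pM pC
  ring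

/-- `(2,2,2) = N(B + T(2)) + pB + Σ_e M(B, T, e)`. -/
theorem starSumM_222_pieces :
    starSumM (R := R) F z τ ends o a₁ a₂ a₃ b v₁ v₂ v₃ 2 2 2 =
      pE2 F z τ ends o a₁ a₂ a₃ b (cliq {v₁, v₂, v₃}) +
        pB F z τ ends o a₁ a₂ a₃ b (cliq {v₁, v₂}) (cliq {v₁, v₃}) (cliq {v₂, v₃}) +
        (pM F z τ ends o a₁ a₂ a₃ b (cliq {v₁, v₂, v₃}) (cliq {v₁, v₂}) +
          pM F z τ ends o a₁ a₂ a₃ b (cliq {v₁, v₂, v₃}) (cliq {v₁, v₃}) +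
          pM F z τ ends o a₁ a₂ a₃ b (cliq {v₁, v₂, v₃}) (cliq {v₂, v₃})) := by
  unfold starSumM
  simp only [Fintype.sum_bool, Bool.toNat_true, Bool.toNat_false, Nat.reduceEqDiff, if_true,
    if_false, add_zero, zero_add, sMask_fff, sMask_tff, sMask_ftf, sMask_fft, sMask_ttf, sMask_tft,
    sMask_ftt, sMask_ttt]
  unfold pE2 pM pB
  ring

end Pieces

end Mask

end TypedRed

end CovForm

end Summit.Ventures.PercRepro2
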